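import Mathlib
import HarnessLib
import Literature.AlgebraicGeometry.Ramification.InertiaNormalSylow

/-!
# p-closedness modulo a central subgroup of order prime to `p` (Phase 0 tower analysis, crux `WildQuotients.WildQuotientResolution`)

Crux stmt-ResolutionOfSingularities-15640 (`WildQuotientResolution`), registered stub
`stub_phaseZeroHighDim` (Phase 0: equivariant regular model with p-closed inertia everywhere),
move-game track of `Theorems/…PointMove`, `…CurveStep`, `…FlagStepPoint`. One group-theoretic
input of the TERMINATION analysis of towers of point moves (this hand's evidence memo
`PHASE0-DIM3-TERMINATION.md` on the item): along a point blow-up at `z`, the inertia `I` of a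
non-p-closed point `x` over `z` acts on the tangent hyperplane `T_x E = Hom(L, V/L)` of the
exceptional divisor through the TWIST of its action on `V/L` by the character on the line `L`;
the image in `GL(Hom(L, V/L))` is the quotient of the image in `GL(V/L)` by a CENTRAL subgroup of
scalars, of order prime to `p` (a finite subgroup of `κˣ`). The lemma below says that such a
quotient cannot turn a non-p-closed group into a p-closed one — so "non-p-closed on the 2-plane"
propagates from one storey of the tower to the next.

* `normal_of_le_center'` — a subgroup of the centre is normal (packaging).
* `eq_one_of_isPGroup_of_not_dvd` — an element of `p`-power order in a subgroup of order prime
  to `p` is trivial.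
* `HasNormalSylow.of_quotient_le_center` — **if `Z ≤ Z(G)` has order prime to `p` and `G/Z` has a
  normal Sylow `p`-subgroup, then so does `G`.** (Elementwise proof: for a Sylow `P` of `G` its
  image is THE Sylow of `G/Z`, so `g x g⁻¹ ∈ P·Z` for `x ∈ P`; the `Z`-component has `p`-power
  order and order prime to `p`, hence is `1`.)
* `not_hasNormalSylow_quotient_of_le_center` — contrapositive, the form used in the tower.

[OURS · crux stmt-ResolutionOfSingularities-15640 · helper toward `stub_phaseZeroHighDim`
(termination of the point-move towers, dim 3); folklore group theory, counted 0; AI-level work,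
weaker than expert review.]
-/

-- single-problem summit: the doubled namespace component `ResolutionOfSingularities` is forced
set_option linter.dupNamespace false

namespace Summit.ResolutionOfSingularities.ResolutionOfSingularities.Theorems.WildQuotientResolution.CentralQuotientNormalSylow

open Literature.AlgebraicGeometry.Ramification

variable {p : ℕ} {G : Type*} [Group G]

/-- A subgroup contained in the centre is normal. [folklore] -/
theorem normal_of_le_center' (Z : Subgroup G) (hZ : Z ≤ Subgroup.center G) : Z.Normal := by
  refine ⟨fun z hz g => ?_⟩
  have hc : g * z = z * g := Subgroup.mem_center_iff.mp (hZ hz) g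
  rw [hc, mul_inv_cancel_right]
  exact hz

/-- An element of `p`-power order lying in a subgroup of order prime to `p` is trivial.
[folklore] -/
theorem eq_one_of_isPGroup_of_not_dvd [hp : Fact p.Prime] [Finite G] (Z : Subgroup G)
    (hpZ : ¬ p ∣ Nat.card Z) {z : G} (hz : z ∈ Z) {n : ℕ} (hzn : z ^ p ^ n = 1) : z = 1 := by
  have h1 : orderOf z ∣ p ^ n := orderOf_dvd_of_pow_eq_one hzn
  have h2 : orderOf z ∣ Nat.card Z := Z.orderOf_dvd_natCard hz
  have hcop : Nat.Coprime (p ^ n) (Nat.card Z) :=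
    Nat.Coprime.pow_left n ((Nat.Prime.coprime_iff_not_dvd hp.out).mpr hpZ)
  have h3 : orderOf z ∣ Nat.gcd (p ^ n) (Nat.card Z) := Nat.dvd_gcd h1 h2
  rw [hcop, Nat.dvd_one] at h3
  exact orderOf_eq_one_iff.mp h3

/-- **p-closedness lifts through a central subgroup of order prime to `p`.** Let `G` be a finite
group, `Z ≤ Z(G)` a central subgroup with `p ∤ |Z|`. If `G/Z` has a normal Sylow `p`-subgroup, then
so does `G`. Proof: let `P` be a Sylow `p`-subgroup of `G`; its image in `G/Z` is a Sylow
`p`-subgroup, hence THE normal one; so for `x ∈ P`, `g ∈ G` the class of `g x g⁻¹` lies in the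
image of `P`, i.e. `g x g⁻¹ = x' z` with `x' ∈ P`, `z ∈ Z`; `z` commutes with `x'`, so
`z^(p^k) = (g x g⁻¹)^(p^k) · x'^(-p^k) = 1` for `k` large, and `z = 1` since `|Z|` is prime to `p`;
thus `g x g⁻¹ = x' ∈ P` and `P` is normal. (Equivalently: `P` is characteristic in `P × Z ⊴ G`.)
[folklore] -/
theorem HasNormalSylow.of_quotient_le_center [hp : Fact p.Prime] [Finite G] (Z : Subgroup G)
    (hZ : Z ≤ Subgroup.center G) (hpZ : ¬ p ∣ Nat.card Z) [Z.Normal]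
    (hQ : HasNormalSylow p (G ⧸ Z)) : HasNormalSylow p G := by
  classical
  obtain ⟨P⟩ := (inferInstance : Nonempty (Sylow p G))
  have hsurj : Function.Surjective (QuotientGroup.mk' Z) := QuotientGroup.mk'_surjective Z
  have hPn : ((P.mapSurjective hsurj : Sylow p (G ⧸ Z)) : Subgroup (G ⧸ Z)).Normal :=
    hQ.normal _
  rw [Sylow.coe_mapSurjective] at hPn
  refine ⟨P, ⟨fun x hx g => ?_⟩⟩
  -- the class of `g x g⁻¹` lies in the image of `P`
  have hmem : QuotientGroup.mk' Z (g * x * g⁻¹) ∈ (P : Subgroup G).map (QuotientGroup.mk' Z) := by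
    have h := hPn.conj_mem _ (Subgroup.mem_map_of_mem (QuotientGroup.mk' Z) hx)
      (QuotientGroup.mk' Z g)
    simpa only [map_mul, map_inv] using h
  obtain ⟨x', hx', hxx'⟩ := Subgroup.mem_map.mp hmem
  -- `g x g⁻¹ = x' * z` with `z ∈ Z` central
  have hzZ : x'⁻¹ * (g * x * g⁻¹) ∈ Z := by
    rw [QuotientGroup.mk'_apply, QuotientGroup.mk'_apply] at hxx'
    exact QuotientGroup.eq.mp hxx'
  set z := x'⁻¹ * (g * x * g⁻¹) with hzdef
  have hdec : g * x * g⁻¹ = x' * z := by rw [hzdef, mul_inv_cancel_left]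
  have hcomm : Commute x' z := (Subgroup.mem_center_iff.mp (hZ hzZ) x')
  -- orders: `x'` and `g x g⁻¹` have `p`-power order
  obtain ⟨n, hn⟩ := P.isPGroup' ⟨x', hx'⟩
  have hn' : x' ^ p ^ n = 1 := by
    have := congrArg Subtype.val hn
    simpa using this
  obtain ⟨m, hm⟩ := P.isPGroup' ⟨x, hx⟩
  have hm' : x ^ p ^ m = 1 := by
    have := congrArg Subtype.val hm
    simpa using this
  have hconj : (g * x * g⁻¹) ^ p ^ m = 1 := by
    rw [conj_pow, hm', mul_one, mul_inv_cancel]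
  -- hence `z ^ p ^ (n + m) = 1`
  have hz1 : z ^ p ^ (n + m) = 1 := by
    have h1 : (x' * z) ^ p ^ (n + m) = x' ^ p ^ (n + m) * z ^ p ^ (n + m) := hcomm.mul_pow _
    have h2 : (x' * z) ^ p ^ (n + m) = 1 := by
      rw [← hdec, pow_add, pow_mul', hconj, one_pow]
    have h3 : x' ^ p ^ (n + m) = 1 := by rw [pow_add, pow_mul, hn', one_pow]
    rw [h2, h3, one_mul] at h1
    exact h1.symm
  have hz : z = 1 := eq_one_of_isPGroup_of_not_dvd Z hpZ hzZ hz1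
  rw [hdec, hz, mul_one]
  exact hx'

/-- **Contrapositive (the form used along a tower of point moves):** if `G` is finite and NOT
p-closed, and `Z ≤ Z(G)` has order prime to `p`, then `G/Z` is not p-closed either — twisting a
non-p-closed linear action by a character (which divides the image by a central group of
scalars, of order prime to `p`) keeps it non-p-closed. [folklore] -/
theorem not_hasNormalSylow_quotient_of_le_center [Fact p.Prime] [Finite G] (Z : Subgroup G)
    (hZ : Z ≤ Subgroup.center G) (hpZ : ¬ p ∣ Nat.card Z) [Z.Normal]
    (hG : ¬ HasNormalSylow p G) : ¬ HasNormalSylow p (G ⧸ Z) :=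
  fun hQ => hG (HasNormalSylow.of_quotient_le_center Z hZ hpZ hQ)

end Summit.ResolutionOfSingularities.ResolutionOfSingularities.Theorems.WildQuotientResolution.CentralQuotientNormalSylow
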